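import Literature.NumberTheory.Automorphic.ResGLnCohomology
import Literature.NumberTheory.GaloisRepresentations.GrossencharakterIdeleValue
import HarnessLib

/-!
# Hecke eigensystems in the cohomology of `Res_{F/ℚ} GL₂` are cuspidal or Eisenstein
# (Harder 1987; named fact, `F` totally real)

Topic `NumberTheory/Automorphic`; namespace `Literature.NumberTheory.Automorphic`, grouping
sub-namespace `ResGLnCohomology` (that of the receptacle
`ResGLnCohomology.levelCohomology k n K 𝔫 λ q = H^q(GL_n(K)⁺, Fun(GL_n(𝔸_K^∞)/K_f(𝔫), E_λ(k)))`,
`E_λ = ⊗_{τ : K →+* k} V_{λ_τ}`, with its unramified Hecke operators `heckeT … v i = T_{v,i}`,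
`ResGLnCohomology.lean`).  ONE NAMED FACT (`def … : Prop`, D-0014), the EXHAUSTION companion of
`ResGLnCohomology.cuspidalEigenclass_exists` (`ResGLnCuspidalEigenclass.lean`, the realisation of
cuspidal `π` in the receptacle) for `n = 2` over a totally real field, and the `Res_{F/ℚ} GL₂`
analogue of the pair `bianchi_interiorEigenclass_isCuspidal` /
`bianchi_boundaryEigensystem_isReducible` (`BianchiOrdinaryClassicality.lean`, `GL₂` over an
imaginary quadratic field on the parallel-weight receptacle `ParallelWeight.cohomology`):

* `ResGLnCohomology.Harder1987_eigensystem_cuspidalOrEisenstein` — for `F` totally real, a level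
  `𝔫 ≠ 0`, ANY weight `λ = (λ_τ)_{τ : F →+* E}` and ANY degree `q`, over a field `E ≃+* ℂ`: a
  non-zero class `c ∈ H^q(S_{K_f(𝔫)}, Ẽ_λ(E))` which is an eigenvector of `T_{w,1}, T_{w,2}` with
  eigenvalues `a_{w,1}, a_{w,2}` for almost all `w` carries EITHER the eigensystem of a regular
  algebraic cuspidal automorphic representation `π₀` of `GL₂(𝔸_F)`
  (`ι a_{w,1} = q_w^{1/2} e₁(α_w)`, `ι a_{w,2} = e₂(α_w)` a.e., `α_w` the Satake parameters in the
  normalisation of `AutomorphicRepData.HasSatakeParamAt`) OR an Eisenstein / residual eigensystem: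
  two algebraic Größencharaktere `ψ₁, ψ₂` of `F` (`IsGrossencharakter`, type `A₀`) with
  `ι a_{w,1} = ψ₁(w) + ψ₂(w)`, `N(w) ι a_{w,2} = ψ₁(w) ψ₂(w)` a.e.

## What is printed, and where

* Harder 1987 (for `G = Res_{F/ℚ} GL₂`, `F` ANY number field, any rational coefficient system `M̃`,
  any level): §2.6 Thm. 1 (p. 56) — the cohomology of the Borel–Serre boundary `H^•(∂S_K, M̃)` is,
  as a module under `G(𝔸_f)` (Hecke algebra), induced from the algebraic Hecke characters
  `φ = (φ₁, φ₂)` of the split torus `T(ℚ)\T(𝔸)` of the types `w · λ` (Kostant), so that its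
  unramified Hecke eigensystems are `T_{w,1} ↦ N(w) φ₁(w) + φ₂(w)`, `T_{w,2} ↦ φ₁(w) φ₂(w)`
  (spherical vector of the induced representation); §3.1 (3.1.1)–(3.1.4) (pp. 59–61) — the
  discrete spectrum of `GL₂` consists of the characters `φ ∘ det` and the cuspidal representations
  (Gelbart–Jacquet), Borel's theorems give `H^•_cusp ⊆ H^•_! ⊆ Im(I_∞)`; §3.2 Prop. 3.2.4 and (3.2.5)
  (pp. 62–66) — `H^•_! = H^•_cusp ⊕ H^•_{!,res}`, the residual classes being those of the
  one-dimensional `φ ∘ det` (`φ` of type `A₀`, only for `dim M = 1`, through the invariant forms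
  `ω_J`, `∅ ≠ J ⊊ S_∞`; eigensystem `T_{w,1} ↦ φ(w)(N(w) + 1)`, `T_{w,2} ↦ φ(w)²`), and
  `H^•_cusp = ⊕_{π ∈ Coh(M)} H^•(𝔤_∞, K_∞; H_{π,∞} ⊗ M_ℂ) ⊗ H_{π,f}^{K_f}` over the finitely many
  CUSPIDAL `π` with `π_∞` cohomological for `M`; §4.2 Thm. 2 (pp. 77–78) —
  `H^•(S_K, M̃_ℂ) = H^•_!(S_K, M̃_ℂ) ⊕ H^•_Eis(S_K, M̃_ℂ)` Hecke-equivariantly with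
  `H^•_Eis ≅ Im(r : H^• → H^•(∂S_K, M̃))` spanned by Eisenstein classes (values, derivatives and
  residues of Eisenstein series attached to the `φ`).  Hence every Hecke eigensystem (at the good
  places) of the finite-dimensional `H^•(S_{K_f}, M̃)` is that of a cuspidal cohomological `π` or
  of a pair `(N φ₁, φ₂)` / `(N φ, φ)` of type-`A₀` Größencharaktere — the two clauses of the fact
  with `ψ₁ = N φ₁`, `ψ₂ = φ₂` (`ψ₁ + ψ₂ = a₁`, `ψ₁ ψ₂ = N φ₁ φ₂ = N a₂`).
* Franke 1998, Thm. 18, and Franke–Schwermer 1998 (exposition: Schwermer 2010, §13.3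
  (13.8)–(13.10)): for every reductive `G/ℚ`, in the adelic model
  `S_{K_f} = G(ℚ) A_G(ℝ)°\G(𝔸)/K_∞K_f` with coefficients in an algebraic `E`,
  `H^•(S, Ẽ) = H^•(𝔤, K_∞; 𝒜(G) ⊗ E) = ⊕_{{P}} H^•(𝔤, K_∞; 𝒜(G)_{{P}} ⊗ E)`, the summand `{G}`
  being the cuspidal cohomology and `𝒜(G)_{{P}}` being spanned by Eisenstein series, derivatives
  and residues attached to cuspidal automorphic representations of the Levi quotients of `P`; for
  `GL₂` the classes are `{G}` (cuspidal) and `{B}` (Levi `GL₁ × GL₁`: pairs of Hecke characters),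
  which is the statement above in the `A_G(ℝ)°K_∞°`-model used by `ResGLnCohomology`
  (`S_{K_f} = GL₂(F)⁺\(X⁺ × G(𝔸_f)/K_f)`, `X⁺` contractible with finite isotropy,
  Schwermer 2010 §5.1, §5.3).
* A cuspidal `π` with `H^•(𝔤_∞, K_∞°; π_∞ ⊗ E_λ) ≠ 0` has the infinitesimal character of `E_λ^∨`
  (Wigner's lemma, Borel–Wallach I Thm. 5.3) and is regular algebraic (Clozel 1990, Lemme 3.14);
  the double coset `T_{w,i}` acts on the spherical line of `π_w` by `q_w^{i(2−i)/2} e_i(α_w)`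
  (Satake–Tamagawa) — in the tree this is the DEFINITION of `HasSatakeParamAt`.
* The `φ_i` are algebraic Hecke characters of type `A₀` (their infinity types are integral,
  `w · (λ + ρ) − ρ`), i.e. Größencharaktere in the sense of Weil 1956 §1 / Neukirch VII (6.1) — the
  tree's `IsGrossencharakter 𝔣 p q ψ` (`GrossencharakterIdeleValue.lean`), with `N` of type `(1, ·)`
  and products of Größencharaktere again Größencharaktere (`GrossencharakterAlgebra.lean`).

## Lean rendering and design

* ONE disjunctive fact instead of the Bianchi pair "interior ⇒ cuspidal" + "non-interior ⇒
  reducible": over a totally real `F` of degree `≥ 2` the interior cohomology with one-dimensional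
  coefficients contains the residual classes `ω_J` of `φ ∘ det` (Harder (3.2.5)), which are NOT
  cuspidal, so "interior ⇒ cuspidal" would be false there; and the receptacle `ResGLnCohomology`
  has (deliberately) no interior part.  The Galois side (Weil's `p`-adic characters of `ψ₁, ψ₂`,
  their sum, Chebotarev + Brauer–Nesbitt against an irreducible `ρ`) is NOT part of the fact: it is
  proved in the tree (`ReducibleGaloisRepOfCharacters.lean`, `LAdicRepFrobenius.lean`).
* `E ≃+* ℂ` (transport of structure of the printed `E = ℂ`: `E_λ`, the cohomology and the Hecke
  operators are defined uniformly in the coefficient field, the embeddings `F →+* E` correspond to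
  `F →+* ℂ` along `ι`), exactly as in `bianchi_interiorEigenclass_isCuspidal`, so that the fact
  applies to `E = ℚ̄_p` without a base-change theorem for `groupCohomology`.
* ANY `λ`: for non-dominant `λ_τ` the factor `V_{λ_τ}` of `GLnCohomology.CoeffModule` is the
  one-dimensional `det^{λ_{τ,1}}` (the Weyl module of the empty partition), so `E_λ` is always an
  irreducible algebraic representation of `Res_{F/ℚ} GL₂`; for an impure `λ` (`λ_{τ,0} + λ_{τ,1}`
  depending on `τ` after this truncation) the central units act non-trivially on `E_λ` and the
  receptacle is `0`, so the hypothesis `c ≠ 0` cannot be met.  ANY degree `q`.  `𝔫 ≠ 0` (at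
  `𝔫 = 0` the level is junk).  Eigen-equations and conclusions are `∀ᶠ w in cofinite` (no
  `K_f(𝔫)`-versus-`S` bookkeeping; `T_{w,i}` is spherical exactly at `w ∤ 𝔫`).
* The cuspidal clause records `π₀.1.IsRegularAlgebraic` (what consumers twist to `L`-algebraic)
  rather than the `τ`-dependent cohomological infinity type; `hcpt` is the (proof-irrelevant)
  compactness datum of `CuspidalAutomorphicRepData`.
* Special case consumed by route `Langlands/EisensteinGelfandKirillov`, crux
  `CrystallineProModularClassical`, line `torsion-weight-exchange` (stub S5, the
  Eichler–Shimura–Harder dictionary with Eisenstein exclusion).  TODO(general form): any number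
  field `F` (Harder's theorem is stated for all `F`; complex places only change the types of the
  Größencharaktere), and `GL_n` with the Franke–Schwermer classes `{P}`.

Nothing is proved here; users take `(h : ResGLnCohomology.Harder1987_eigensystem_cuspidalOrEisenstein)`.
`lean search 'cuspidalOrEisenstein\|interiorEigenclass_isCuspidal\|Eigensystem_isReducible'`: only
the Bianchi pair and `GLnCohomology.interiorEigenclass_isCuspidal` (`F = ℚ`); nothing on the
exhaustion side for `ResGLnCohomology`.

## References

* G. Harder, *Eisenstein cohomology of arithmetic groups. The case GL₂*, Invent. Math. 89 (1987)
  37–118: §2.6 Thm. 1 (p. 56), §3.1 (3.1.1)–(3.1.4) (pp. 59–61), §3.2 Prop. 3.2.4 and (3.2.5)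
  (pp. 62–66), §4.2 Thm. 2 (pp. 77–78) (store: acq-04651, cite-only). [Harder1987]
* J. Franke, *Harmonic analysis in weighted L₂-spaces*, Ann. Sci. ÉNS 31 (1998), Thm. 18.
  [Franke1998]
* J. Franke, J. Schwermer, *A decomposition of spaces of automorphic forms, and the Eisenstein
  cohomology of arithmetic groups*, Math. Ann. 311 (1998) 765–790 (acq-05188). [FrankeSchwermer1998]
* J. Schwermer, *Geometric cycles, arithmetic groups and their cohomology*, Bull. AMS 47 (2010),
  §5.1, §5.3, §13.3 (13.8)–(13.10) (held; read 2026-08-17). [Schwermer2010]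
* L. Clozel, *Motifs et formes automorphes* (1990), Lemme 3.14. [Clozel1990]
* A. Borel, N. Wallach (2000), I Thm. 5.3. [BorelWallach2000]
* A. Weil (1956), §1. [Weil1956]  T. Tamagawa (1963). [Tamagawa1963]
-/

noncomputable section

open scoped Classical
open NumberField IsDedekindDomain

namespace Literature.NumberTheory.Automorphic

namespace ResGLnCohomology

open Literature.NumberTheory.GaloisRepresentations

/-- NAMED FACT — **Harder: the Hecke eigensystems in the cohomology of `Res_{F/ℚ} GL₂` with
algebraic coefficients are cuspidal cohomological or Eisenstein** (`GL₂` over a totally real field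
`F`; printed for every number field).  For a field `E` with a ring isomorphism `ι : E ≃+* ℂ`
(transport of structure of the printed case `E = ℂ`), a level `𝔫 ≠ 0`, ANY weight
`λ = (λ_τ)_{τ : F →+* E}` and degree `q`, and a NON-ZERO class
`c ∈ H^q(S_{K_f(𝔫)}, Ẽ_λ(E)) = levelCohomology E 2 F 𝔫 λ q` which for almost all finite places `w`
is an eigenvector of `T_{w,1}` and `T_{w,2}` (`heckeT`) with eigenvalues `a_{w,1}, a_{w,2}`: EITHER
there is a CUSPIDAL automorphic representation `π₀` of `GL₂(𝔸_F)` (`CuspidalAutomorphicRepData`),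
regular algebraic (`π₀,∞` is cohomological: `π₀,∞ ⊗ E_λ` has the infinitesimal character of the
trivial representation), whose Satake parameters `α_w` (`HasSatakeParamAt`, normalisation
`T_{w,i} ↦ q_w^{i(2−i)/2} e_i(α)`) satisfy `ι(a_{w,1}) = q_w^{1/2} e₁(α_w)`, `ι(a_{w,2}) = e₂(α_w)`
for almost all `w`; OR there are two algebraic Größencharaktere `ψ₁, ψ₂` of `F` modulo some
`𝔣 ≠ 0` (`IsGrossencharakter`, type `A₀`) with `ι(a_{w,1}) = ψ₁(w) + ψ₂(w)` and
`N(w) · ι(a_{w,2}) = ψ₁(w) ψ₂(w)` for almost all `w` (the eigensystems `(N φ₁ + φ₂, φ₁ φ₂)` of the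
Eisenstein classes induced from the pair `(φ₁, φ₂)` and `(φ (N + 1), φ²)` of the residual classes
`φ ∘ det`).  Printed: `H^• = H^•_! ⊕ H^•_Eis`, `H^•_Eis ≅ Im(H^• → H^•(∂S_K, M̃))`
[cite: Harder1987, §4.2 Thm. 2 (pp. 77–78)], the boundary cohomology induced from the algebraic
Hecke characters of the split torus [cite: Harder1987, §2.6 Thm. 1 (p. 56)],
`H^•_! = H^•_cusp ⊕ H^•_{!,res}` and `H^•_cusp = ⊕_π H^•(𝔤_∞, K_∞; π_∞ ⊗ M_ℂ) ⊗ π_f^{K_f}` over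
cuspidal cohomological `π`, the residual classes being those of `φ ∘ det`
[cite: Harder1987, §3.1 (3.1.1)–(3.1.4) and §3.2 Prop. 3.2.4, (3.2.5)]; in the adelic
`A_G(ℝ)°K_∞°`-model of this receptacle, Franke's `H^• = H^•_cusp ⊕ H^•_Eis` with the decomposition
along the associate classes `{G}, {B}` [cite: Franke1998, Thm. 18] [cite: FrankeSchwermer1998]
[cite: Schwermer2010, §13.3 (13.8)–(13.10)]; cohomological `π_∞` are regular algebraic
[cite: Clozel1990, Lemme 3.14] [cite: BorelWallach2000, I Thm. 5.3]; `T_{w,i}` acts on the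
spherical line by the Satake–Tamagawa scalar [cite: Tamagawa1963]; Größencharaktere of type `A₀`
[cite: Weil1956, §1].  Unproved in the tree; users take
`(h : ResGLnCohomology.Harder1987_eigensystem_cuspidalOrEisenstein)`.  Special case (`n = 2`,
`F` totally real) consumed by a route; general form TODO.
[cite: Harder1987, §2.6 Thm. 1, §3.1 (3.1.1)–(3.1.4), §3.2 Prop. 3.2.4 and (3.2.5), §4.2 Thm. 2] -/
def Harder1987_eigensystem_cuspidalOrEisenstein : Prop :=
  ∀ (F : Type) [Field F] [NumberField F], NumberField.IsTotallyReal F →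
    ∀ (hcpt : isCompact_glFiniteIntegralLevel 2 F) (E : Type) [Field E] (ι : E ≃+* ℂ)
      (𝔫 : Ideal (𝓞 F)), 𝔫 ≠ 0 →
    ∀ (lam : (F →+* E) → Fin 2 → ℤ) (q : ℕ) (c : levelCohomology E 2 F 𝔫 lam q), c ≠ 0 →
    ∀ (a : HeightOneSpectrum (𝓞 F) → ℕ → E),
      (∀ᶠ w in Filter.cofinite, heckeT E 2 F 𝔫 lam q w 1 c = a w 1 • c ∧
        heckeT E 2 F 𝔫 lam q w 2 c = a w 2 • c) →
      (∃ π₀ : CuspidalAutomorphicRepData 2 F hcpt, π₀.1.IsRegularAlgebraic ∧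
        ∀ᶠ w in Filter.cofinite, ∃ α : Multiset ℂ, π₀.1.HasSatakeParamAt w α ∧
          ι (a w 1) = ((Real.sqrt (w.residueCard : ℝ) : ℝ) : ℂ) * α.esymm 1 ∧ ι (a w 2) = α.esymm 2) ∨
      (∃ (𝔣 : Ideal (𝓞 F)) (p₁ q₁ p₂ q₂ : InfinitePlace F → ℤ) (ψ₁ ψ₂ : HeightOneSpectrum (𝓞 F) → ℂ),
        𝔣 ≠ ⊥ ∧ IsGrossencharakter 𝔣 p₁ q₁ ψ₁ ∧ IsGrossencharakter 𝔣 p₂ q₂ ψ₂ ∧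
        ∀ᶠ w in Filter.cofinite, ι (a w 1) = ψ₁ w + ψ₂ w ∧
          ((Ideal.absNorm w.asIdeal : ℕ) : ℂ) * ι (a w 2) = ψ₁ w * ψ₂ w)

end ResGLnCohomology

end Literature.NumberTheory.Automorphic

end
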